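import Literature.NumberTheory.LFunctions.UniformClassGroupPNTGeneralDegreeInputs
import Literature.NumberTheory.NumberFields.PureCubicDiscriminantBound
import HarnessLib

/-!
# Crude a-priori class-number bounds: `h_K ≤ 11^{n_K} |d_K|`; `h_K ≤ 11³ · 27a²b²` for a pure cubic field

Topic `Literature/NumberTheory/NumberFields`. Integer-valued corollaries of the tree's uniform
bound `h_K ≤ (4e)^{n_K} |d_K|`
(`Literature.NumberTheory.LFunctions.NumberField.classNumber_le_exp_mul_absdiscr`: Minkowski's
bound on ideal-class representatives, Mathlib `NumberField.exists_ideal_in_class_of_norm_le`,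
plus the count `#{𝔞 : N𝔞 ≤ N} ≤ N² ζ_K(2) ≤ N² e^{n_K}` of integral ideals of bounded norm), in
the form consumed by class-group algorithms as an a-priori bound on the group order:

* `classNumber_le_pow_mul_natAbs_discr` — `h_K ≤ 11^{n_K} · |d_K|` for every number field `K`
  (`4e < 11`);
* `PureCubic.classNumber_le` — for a cubic field `K ∋ θ` with `θ³ = ab²`, `ab` squarefree,
  `ab ≠ 1`: `h_K ≤ 11³ · 27 a² b²` (by the tree's `PureCubic.abs_discr_le`, `|d_K| ≤ 27 a² b²`).

Sharper bounds (`h_K ≪ |d_K|^{1/2} (log |d_K|)^{n_K − 1}`, or the exact Minkowski constant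
`(4/π) · 3!/3³` of a complex cubic field) are deliberately NOT here.

## References

* J. Thorner, A. Zaman, *A unified and improved Chebotarev density theorem*, Algebra Number
  Theory 13 (2019), Lemma 2.4 (proof: `h_K ≤ D_K e^{O(n_K)}`). [ThornerZaman2019]
* H. Cohen, *A Course in Computational Algebraic Number Theory*, GTM 138, Springer 1993, §6.4.5
  (discriminant of a pure cubic field). [Cohen1993]
-/

namespace Literature.NumberTheory.NumberFields

open scoped NumberField
open NumberField Module

variable {K : Type*} [Field K] [NumberField K]

variable (K) in
/-- **`h_K ≤ 11^{n_K} · |d_K|`** for every number field `K`: the integer form of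
`h_K ≤ (4e)^{n_K} |d_K|` (every ideal class contains an integral ideal of norm `≤ 2^{n_K} √|d_K|`
by Minkowski, and there are at most `N² e^{n_K}` integral ideals of norm `≤ N`), using `4e < 11`.
[cite: ThornerZaman2019, Lemma 2.4 (proof)] -/
theorem classNumber_le_pow_mul_natAbs_discr :
    classNumber K ≤ 11 ^ finrank ℚ K * (discr K).natAbs := by
  have h := Literature.NumberTheory.LFunctions.NumberField.classNumber_le_exp_mul_absdiscr K
  have he : 4 * Real.exp 1 ≤ (11 : ℝ) := by
    have := Real.exp_one_lt_d9
    linarith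
  have h2 : (classNumber K : ℝ) ≤ (11 : ℝ) ^ finrank ℚ K * |(discr K : ℝ)| :=
    h.trans (mul_le_mul_of_nonneg_right (pow_le_pow_left₀ (by positivity) he _) (abs_nonneg _))
  have h3 : ((classNumber K : ℕ) : ℝ) ≤ ((11 ^ finrank ℚ K * (discr K).natAbs : ℕ) : ℝ) := by
    push_cast
    rw [Nat.cast_natAbs, Int.cast_abs]
    exact h2
  exact_mod_cast h3

namespace PureCubic

/-- **`h_K ≤ 11³ · 27 a² b²`** for a cubic field `K ∋ θ`, `θ³ = ab²`, `ab` squarefree, `ab ≠ 1`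
(`h_K ≤ 11^{n_K} |d_K|` with `n_K = 3`, and `|d_K| ≤ 27 a² b²`). [folklore] -/
theorem classNumber_le (hdeg : finrank ℚ K = 3) {a b : ℕ} (hab : Squarefree (a * b))
    (hab1 : a * b ≠ 1) {θ : K} (hθ : θ ^ 3 = ((a * b ^ 2 : ℕ) : K)) :
    classNumber K ≤ 11 ^ 3 * (27 * a ^ 2 * b ^ 2) := by
  have h1 := classNumber_le_pow_mul_natAbs_discr K
  rw [hdeg] at h1
  have h2 := abs_discr_le hdeg hab hab1 hθ
  have h3 : (discr K).natAbs ≤ 27 * a ^ 2 * b ^ 2 := by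
    have : ((discr K).natAbs : ℤ) ≤ 27 * (a : ℤ) ^ 2 * (b : ℤ) ^ 2 := by
      rw [Int.natCast_natAbs]
      exact h2
    exact_mod_cast this
  exact h1.trans (Nat.mul_le_mul_left _ h3)

end PureCubic

end Literature.NumberTheory.NumberFields
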